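import Mathlib

/-!
# Sketch — crux idea `irred-vertex-anchor` (cruxidea seat 2, g16) for KS′ = `LevelKolyvaginSystemsAdditive`
(stmt-BirchSwinnertonDyer-21396, route AdditiveKolyvaginRoad).

FIRST LEMMA (checkable, proved here by `decide`): the LOCATED TABLE of the card is a finite arithmetic statement.
For an additive potentially-good prime `p ≥ 5` of semistability defect `e ∈ {3,4,6}` with `e ∤ p−1`
("B-cell" = potentially supersingular), write `ρ̄_{E,p}|I_p ≃ ω₂^m ⊕ ω₂^{pm}` with
`m = 1 + (p²−1)/e` for the starred Kodaira types (II*, III*, IV*) and `m = 1 − (p²−1)/e` for II, III, IV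
(conventions calibrated on TRIAGE-r1-1 v18's hand computation at p = 5).  BDJ Serre weights of the class:
`m = (r+1) + (p+1)s`, `W = {σ_{r,s}, σ_{p−1−r,r+s}}` (σ_{a,b} = Symᵃ ⊗ detᵇ); Jordan–Hölder factors of the
reduced cuspidal type of index `e` (Diamond): `n = (p²−1)/e = i + (p+1)j`, `JH = {σ_{i−2,j+1}, σ_{p−1−i,i+j}}`;
"T-good" (a torus-fixed vector after the self-dual normalisation) = `a` even ∧ `2b + a ≡ 0 (mod 2(p−1))`;
GOOD half = the Breuil–Mézard weight `W ∩ JH` is T-good; `k_T = a + 2` for the T-good member of `W`.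

`allChecks` verifies, for p ∈ {5, 7, 11, 17, 19, 23, 29} and every B-value of e:
  (1) `m ≢ 0 (mod p+1)` (niveau 2 ⇒ ρ̄|G_{ℚ_p} irreducible = hypothesis (Irred) of Wan, arXiv:1607.07729 Thm 1.4);
  (2) `|W ∩ JH| = 1` and exactly one member of `W` is T-good;
  (3) the starred type is the GOOD half, the unstarred type is BAD;
  (4) on the GOOD half `k_T ≤ p − 1` (so `k_T < p`: Wan Cor 4.35's Fontaine–Laffaille range), and
      `k_T < p − 1` (Kim–Ota arXiv:1905.02926 Cor 5.8 under (CR⁺)) except exactly at `(p,e) = (5,3)` (Kodaira IV*, k_T = 4 = p−1: the EDGE).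
Nothing here is a statement about elliptic curves; it is the combinatorial certificate the card's cell table rests on.
The line's stubs T1–T5 are stated in prose on the card over the tree's sockets
(`AdditiveKoly.levelKolyvaginSystemsAdditive_of_seed`, p592803; `Lines/bdp_rebase.lean` S4 `stub_raisedSeedDivisibleLocus`).
-/

set_option linter.dupNamespace false

namespace Summit.BirchSwinnertonDyer.BirchSwinnertonDyer.Cruxes.LevelKolyvaginSystemsAdditive.IrredVertexAnchor

/-- `σ_{a,b}` recorded as a pair `(a, b mod (p-1))`. -/
abbrev Wt := ℕ × ℕ

def tGood (p : ℕ) (w : Wt) : Bool := w.1 % 2 == 0 && (2 * w.2 + w.1) % (2 * (p - 1)) == 0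

/-- inertia exponent `m` (mod p²−1) of the class attached to `(p, e, starred?)`. -/
def mOf (p e : ℕ) (star : Bool) : ℕ :=
  let M := p * p - 1
  if star then (1 + M / e) % M else (M + 1 - M / e) % M

/-- the two BDJ weights of the niveau-2 class `m`. -/
def bdjWeights (p m : ℕ) : Wt × Wt :=
  let r := m % (p + 1) - 1
  let s := ((m - (r + 1)) / (p + 1)) % (p - 1)
  ((r, s), (p - 1 - r, (r + s) % (p - 1)))

/-- Diamond's two JH factors of the reduced cuspidal type `Θ(ω₂ⁿ)`, `n = i + (p+1) j`;
the first is absent when `i < 2` (we then repeat the second). -/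
def jhType (p n : ℕ) : Wt × Wt :=
  let i := n % (p + 1)
  let j := (n - i) / (p + 1)
  let w2 : Wt := (p - 1 - i, (i + j) % (p - 1))
  if 2 ≤ i then ((i - 2, (j + 1) % (p - 1)), w2) else (w2, w2)

def inter (x y : Wt × Wt) : List Wt :=
  ([x.1, x.2].filter fun w => w == y.1 || w == y.2).eraseDups

/-- GOOD half: the (unique) Breuil–Mézard weight is T-good. -/
def goodHalf (p e : ℕ) (star : Bool) : Bool :=
  let m := mOf p e star
  match inter (bdjWeights p m) (jhType p ((p * p - 1) / e)) with
  | [w] => tGood p w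
  | _ => false

/-- `k_T = a + 2` for the T-good member of `W` (0 if none). -/
def kT (p e : ℕ) (star : Bool) : ℕ :=
  let W := bdjWeights p (mOf p e star)
  if tGood p W.1 then W.1.1 + 2 else if tGood p W.2 then W.2.1 + 2 else 0

def rowCheck (p e : ℕ) : Bool :=
  let M := p * p - 1
  let ms := mOf p e true
  let mu := mOf p e false
  let Ws := bdjWeights p ms
  -- (1) niveau 2 on both halves
  (ms % (p + 1) != 0) && (mu % (p + 1) != 0) &&
  -- (2) unique BM weight, unique T-good weight (starred half)
  ((inter Ws (jhType p (M / e))).length == 1) &&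
  ((tGood p Ws.1) != (tGood p Ws.2)) &&
  -- (3) starred GOOD, unstarred BAD
  goodHalf p e true && !goodHalf p e false &&
  -- (4) Fontaine–Laffaille placement of the GOOD half
  (kT p e true ≤ p - 1) && ((kT p e true < p - 1) || (p == 5 && e == 3))

def bValues (p : ℕ) : List ℕ := [3, 4, 6].filter fun e => (p - 1) % e != 0

def allChecks : Bool :=
  [5, 7, 11, 17, 19, 23, 29].all fun p => (bValues p).all fun e => rowCheck p e

/-- FIRST LEMMA of the card: the located table is correct as a finite computation. -/
theorem allChecks_eq_true : allChecks = true := by decide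

/-- the p = 5 rows by name (calibration against TRIAGE-r1-1 v18): IV* GOOD with k_T = 4 (edge), II* GOOD with k_T = 2,
IV and II BAD; p = 13 has no B-cell. -/
theorem p5_rows :
    goodHalf 5 3 true = true ∧ kT 5 3 true = 4 ∧ goodHalf 5 6 true = true ∧ kT 5 6 true = 2 ∧
    goodHalf 5 3 false = false ∧ goodHalf 5 6 false = false ∧ bValues 13 = [] := by decide

/-- the GOOD halves at p = 7, 11 with their companion weights: (7,III*) k_T = 4; (11,IV*) 8, (11,III*) 6, (11,II*) 4. -/
theorem p7_p11_rows :
    kT 7 4 true = 4 ∧ kT 11 3 true = 8 ∧ kT 11 4 true = 6 ∧ kT 11 6 true = 4 := by decide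

end Summit.BirchSwinnertonDyer.BirchSwinnertonDyer.Cruxes.LevelKolyvaginSystemsAdditive.IrredVertexAnchor
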